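import Literature.IUT.HodgeTheaters.GoodLocalFrobenioidDashSigmaLift
import Literature.IUT.HodgeTheaters.BadLocalFrobenioidDash
import Literature.AlgebraicGeometry.Frobenioids.PadicFrobenioidBadDatumMulTransport
import HarnessLib

/-!
# [IUTchI] Ex 3.2 (iv) / Cor 5.3 (iii) at the genuine BAD place — the MONO-ANALYTIC lift: a topological automorphism `β` of
# `G_v̲ = Gal(K̄_v̲/K_v̲)` together with a `β⁻¹`-equivariant integral multiplicative `σ : K̄_v̲ˣ ⥲ K̄_v̲ˣ` preserving the valuation of `q̲_v̲`
# lifts to a self-equivalence of the GENUINE `𝒞⊢_v̲` (`Φ_{𝒞⊢_v̲} = ℕ·log_Φ(q̲_v̲)`) lying over `pull β` and carrying `τ(q̲_v̲)` onto `τ(q̲_v̲)`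
# (abc-iut-L5-t4, row R80 (b-i) «COR53III-BAD-SLOT»; the bad-place twin of abc-iut-L5-t16's `GoodLocalFrobenioidDashSigmaLift`)

S. Mochizuki, *Inter-universal Teichmüller theory I*, kurims manuscript (May 2020), §3 Example 3.2 (iv) p. 71 («the resulting submonoid
`Φ_{𝒞⊢_v} := ℕ·log_Φ(q̲_v)|_{𝒟⊢_v} ⊆ Φ_{𝒞_v}|_{𝒟⊢_v}` determines a `p_v`-adic Frobenioid with base category given by `𝒟⊢_v` [cf. [FrdII],
Example 1.1, (ii)]»), §4 Definition 4.1 (iii) p. 96 («(a) if `v ∈ 𝕍^non`, then `†𝒟⊢_v` is a category which admits an equivalence of categories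
`†𝒟⊢_v ⥲ 𝒟⊢_v` [where `𝒟⊢_v` is as in Examples 3.2, (i); 3.3, (i)]»), §5 Corollary 5.3 (iii) p. 144 («the natural map
`Isom(¹𝔉⊢, ²𝔉⊢) → Isom(¹𝔇⊢, ²𝔇⊢)` [cf. Remark 5.2.1, (i)] is surjective»; proof p. 144: «follows immediately from […] [AbsTopIII],
Proposition 5.8, (ii), (v)») ([IUTchI] Cor 5.3 (iii) p.144) [claim: Mochizuki2012, status: disputed] (D-0012 claim key; CONSTRUCTIONS and
PROOFS over landed files; nothing of the series is asserted; no side is taken on [IUTchIII] Cor. 3.12).  *The geometry of Frobenioids I*,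
Cor. 5.4 p. 104 [cite: MochizukiFrdI2008, Cor. 5.4 p.104]; *The geometry of Frobenioids II*, Ex. 1.1 (ii) p. 8, Thm. 1.2 (v) p. 9
[cite: MochizukiFrdII2008, Ex 1.1 (ii) p.8].

## What this file proves (cell abc-iut, L5 HUB node `IUTchI:Cor5.3(iii)`, BAD `⊢`-SLOT — the carrier is GENUINE)

abc-iut-L5-t2's `𝒞⊢_v̲` at a bad place is `GaloisValDatum.Cdash d hq = BadLocalKit.Cdash d.relEmb … hq` (abc-iut-L1-t4), the `p_v`-adic
Frobenioid of the MONOGENIC datum `d.dashDatum hq` of the section «image of `q̲_v̲`» over `𝒟⊢_v̲ = CosetCat G_v̲` — it is the third carrier of EVERY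
`TemperedThetaInput` and of racer C's `frobeniusBadAt` (`.Cdash/.CdashBase/.tauDashOf`, rfl), so it does NOT see the tempered input `I.m1` at all
(abc-iut-L5-t4 R78 census; abc-iut-L5-lead RULINGS #145/#147).  For a MULTIPLICATIVE `σ : Ωˣ ⥲ Ωˣ` with `σ (γ • x) = β⁻¹ γ • σ x`, integral, and
`v(σ q̲) = v(q̲)` (`hσq`) — fed through abc-iut-L5-t16's family `DashSigmaLift.tau` (§A of the good twin, datum-free, BY NAME) and this seat's L1
brick `PadicFrd.badDatumMulTransport` (the `q̲`-NORMALISED transport: `σ` on `𝒪^×`, `q̲̂ ↦ q̲̂`):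
* §A `BadDashSigmaLift.relEmbPull` (the `K_v̲`-relative structure of `pull β ⋙ fieldFunctor`), `tau_img` / `tau'_img` (`v(τ_X q̲̂) = v(q̲̂)`);
* §B `dataHomOver` — the brick at `F₁ := d.fieldFunctor`, `F₂ := pull β ⋙ d.fieldFunctor`: a `ModelFrobenioid.DataHomOver (pull β)` between
  `𝒞⊢_v̲`'s OWN data (rfl); §C `lift`, `lift_comp_CdashBase` (ON THE NOSE over `pull β`), `lift_isEquivalence`,
  **`exists_selfEquivalence_liesUnder_pullSelfEquiv`** — for EVERY such `(β, σ)`: a self-equivalence of `d.Cdash hq` lying under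
  `pullSelfEquiv β β⁻¹` through `d.CdashBase hq` (the LiftsAll⊢ content of the bad `⊢`-slot);
* §D `map_cSplittingSubmonoid_eq_of_units` (the `c`-splitting twin of abc-iut-L5-t16 gen 7's `map_pSplittingSubmonoid_eq_of_units`, generic) and
  **`map_tauDash_lift`** — THE LIFT CARRIES `τ(q̲_v̲)` ONTO `τ(q̲_v̲)` (`BadLocalKit.tauDash`; by the brick's `q̲̂ ↦ q̲̂`).  The OTHER members `τ(ζ·q̲_v̲)`
  of the printed `μ_{2l}`-orbit `τ⊢_v̲` go to `τ(σ(ζ)·q̲_v̲)` — the orbit is permuted; not typed here (follow-up).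
Binders (displayed): `d`, `hq`, `β` (`hβc hβc'`), `σ`, `hσ`, `hσint`, `hσq` (+ the inverse family `σ'`); 0 instance · 0 notation · no `Prop`
fact; defs: `relEmbPull`, `dataHomOver`, `lift`.  Print's Cor 5.3 (iii) asserts SURJECTIVITY only; this file supplies lifts and claims no
rigidity.  HONEST FRAMING: OUR transport of OUR datum over the genuine local Galois data; typed ≠ proved for nothing here (no hypotheses of
print are assumed); nothing here asserts abc proved or refuted.
-/

noncomputable section

namespace Literature.IUT.HodgeTheaters

open CategoryTheory Opposite Literature.AnabelianGeometry.SemiGraphs Literature.AlgebraicGeometry.Frobenioids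
open Literature.AlgebraicGeometry.Frobenioids.PadicFrd
open scoped ValuativeRel

namespace BadDashSigmaLift

universe u

/-! ### §A. The `K_v̲`-relative structure along `pull β`; `v(τ_X q̲̂) = v(q̲̂)` -/

section Tau

variable {p : ℕ} [Fact p.Prime] (d : GaloisValDatum.{u} p) (β : d.Gal ≃* d.Gal) (hβc : Continuous β)
  (σ : d.Ωˣ →* d.Ωˣ) (hσ : ∀ (γ : d.Gal) (x : d.Ωˣ), σ (γ • x) = β.symm γ • σ x)
  {q : PadicFrd.intNonzero d.k} (hq : ¬ IsUnit q)
  (hσq : ∀ x : d.Ωˣ, (x : d.Ω) = algebraMap d.k d.Ω (q : d.k) →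
    ValuativeRel.valuation d.Ω (σ x : d.Ω) = ValuativeRel.valuation d.Ω (algebraMap d.k d.Ω (q : d.k)))

/-- **The `K_v̲`-relative structure on `pull β ⋙ fieldFunctor`**: `K_v̲ ↪ Ω^{β⁻¹U}` (abc-iut-L5-t2's `relEmb` at the pulled-back object).
[cite: MochizukiFrdII2008, Ex 1.1 (ii) p.8] -/
def relEmbPull : PadicFrd.RelEmb (DashSigmaLift.baseFunctor₂ d β hβc) d.k where
  emb X := d.relEmb.emb ((CosetCat.pull (β : d.Gal →* d.Gal) hβc β.surjective).obj X)
  isValHom X := d.relEmb.isValHom ((CosetCat.pull (β : d.Gal →* d.Gal) hβc β.surjective).obj X)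
  comp f := d.relEmb.comp ((CosetCat.pull (β : d.Gal →* d.Gal) hβc β.surjective).map f)

include hσq in
/-- **`v(τ_X q̲̂) = v(q̲̂)`** in `Ω^{β⁻¹U}` (hypothesis `hσq` read through the restricted valuation, abc-iut-L5-t16 `valuation_fixedFld_eq_iff`).
[cite: MochizukiFrdII2008, Ex 1.1 (ii) p.8] -/
theorem tau_img (X : CosetCat d.Gal) :
    ValuativeRel.valuation ((DashSigmaLift.baseFunctor₂ d β hβc).obj X).K
        (DashSigmaLift.tau d β hβc σ hσ X
            (PadicFrd.intNonzeroToUnits ((DashSigmaLift.baseFunctor₁ d).obj X).K (d.relEmb.img q X)) :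
          ((DashSigmaLift.baseFunctor₂ d β hβc).obj X).K) =
      ValuativeRel.valuation ((DashSigmaLift.baseFunctor₂ d β hβc).obj X).K
        (((relEmbPull d β hβc).img q X : ↥(PadicFrd.intNonzero ((DashSigmaLift.baseFunctor₂ d β hβc).obj X).K)) :
          ((DashSigmaLift.baseFunctor₂ d β hβc).obj X).K) :=
  (DashSigmaLift.valuation_fixedFld_eq_iff d ((CosetCat.pull (β : d.Gal →* d.Gal) hβc β.surjective).obj X) _ _).mpr
    (hσq (SigmaLift.unitsVal d (d.fixedFld X)
      (PadicFrd.intNonzeroToUnits ((DashSigmaLift.baseFunctor₁ d).obj X).K (d.relEmb.img q X))) rfl)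

variable (σ' : d.Ωˣ →* d.Ωˣ) (hσ' : ∀ (γ : d.Gal) (x : d.Ωˣ), σ' (γ • x) = β γ • σ' x)
  (hσ'q : ∀ x : d.Ωˣ, (x : d.Ω) = algebraMap d.k d.Ω (q : d.k) →
    ValuativeRel.valuation d.Ω (σ' x : d.Ω) = ValuativeRel.valuation d.Ω (algebraMap d.k d.Ω (q : d.k)))

include hσ'q in
/-- `v(τ'_X q̲̂) = v(q̲̂)` in `Ω^U` for the inverse family. [cite: MochizukiFrdII2008, Ex 1.1 (ii) p.8] -/
theorem tau'_img (X : CosetCat d.Gal) :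
    ValuativeRel.valuation ((DashSigmaLift.baseFunctor₁ d).obj X).K
        (DashSigmaLift.tau' d β hβc σ' hσ' X
            (PadicFrd.intNonzeroToUnits ((DashSigmaLift.baseFunctor₂ d β hβc).obj X).K ((relEmbPull d β hβc).img q X)) :
          ((DashSigmaLift.baseFunctor₁ d).obj X).K) =
      ValuativeRel.valuation ((DashSigmaLift.baseFunctor₁ d).obj X).K
        ((d.relEmb.img q X : ↥(PadicFrd.intNonzero ((DashSigmaLift.baseFunctor₁ d).obj X).K)) : ((DashSigmaLift.baseFunctor₁ d).obj X).K) :=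
  (DashSigmaLift.valuation_fixedFld_eq_iff d X _ _).mpr
    (hσ'q (SigmaLift.unitsVal d (d.fixedFld ((CosetCat.pull (β : d.Gal →* d.Gal) hβc β.surjective).obj X))
      (PadicFrd.intNonzeroToUnits ((DashSigmaLift.baseFunctor₂ d β hβc).obj X).K ((relEmbPull d β hβc).img q X))) rfl)

end Tau

/-! ### §B. The data morphism over `pull β` at `𝒞⊢_v̲ = d.Cdash hq` from `(β, σ)` -/

section Lift

variable {p : ℕ} [Fact p.Prime] (d : GaloisValDatum.{u} p) {q : PadicFrd.intNonzero d.k} (hq : ¬ IsUnit q)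
  (β : d.Gal ≃* d.Gal) (hβc : Continuous β)
  (σ : d.Ωˣ →* d.Ωˣ) (hσ : ∀ (γ : d.Gal) (x : d.Ωˣ), σ (γ • x) = β.symm γ • σ x)
  (hσint : ∀ x : d.Ωˣ, ValuativeRel.valuation d.Ω (x : d.Ω) ≤ 1 → ValuativeRel.valuation d.Ω (σ x : d.Ω) ≤ 1)
  (hσq : ∀ x : d.Ωˣ, (x : d.Ω) = algebraMap d.k d.Ω (q : d.k) →
    ValuativeRel.valuation d.Ω (σ x : d.Ω) = ValuativeRel.valuation d.Ω (algebraMap d.k d.Ω (q : d.k)))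

/-- **THE DATA MORPHISM OVER `pull β` induced by `(β, σ)`**: this seat's brick `PadicFrd.badDatumMulTransport` at the base functors
`d.fieldFunctor` and `pull β ⋙ d.fieldFunctor` with their `K_v̲`-relative structures `d.relEmb`, `relEmbPull` — definitionally a
`DataHomOver (pull β)` between the monogenic data of `𝒞⊢_v̲ = d.Cdash hq` itself. [cite: MochizukiFrdI2008, Thm. 5.2(i) p.100] -/
def dataHomOver :
    ModelFrobenioid.DataHomOver (CosetCat.pull (β : d.Gal →* d.Gal) hβc β.surjective) (d.dashDatum hq).divB (d.dashDatum hq).divB :=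
  PadicFrd.badDatumMulTransport (DashSigmaLift.baseFunctor₁ d) (DashSigmaLift.baseFunctor₂ d β hβc) d.relEmb (relEmbPull d β hβc)
    d.fieldFunctor_isPadicLocal
    (GoodLocalFrobenioid.hlocOver (CosetCat.pull (β : d.Gal →* d.Gal) hβc β.surjective) d.fieldFunctor d.fieldFunctor_isPadicLocal)
    CosetCat.isConnected CosetCat.isTotallyEpimorphic hq (DashSigmaLift.tau d β hβc σ hσ)
    (DashSigmaLift.tau_integral d β hβc σ hσ hσint) (fun f u => DashSigmaLift.tau_natural d β hβc σ hσ f u)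
    (tau_img d β hβc σ hσ hσq)

/-! ### §C. The lift and its properties -/

/-- **THE MONO-ANALYTIC LIFT `Ψ⊢_{β,σ} : 𝒞⊢_v̲ ⥤ 𝒞⊢_v̲`** (`(A, n·log q̲) ↦ (β⁻¹A, n·log q̲)`, units by `σ`, `q̲̂ ↦ q̲̂`).
([IUTchI] Cor 5.3 (iii) p.144) [claim: Mochizuki2012, status: disputed] -/
def lift : d.Cdash hq ⥤ d.Cdash hq :=
  (dataHomOver d hq β hβc σ hσ hσint hσq).functor

/-- **`Ψ⊢_{β,σ}` LIES OVER `pull β` ON THE NOSE** through `𝒞⊢_v̲ → 𝒟⊢_v̲ = CosetCat G_v̲` (abc-iut-w5-d048 `DataHomOver.functor_comp_baseFunctor`).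
([IUTchI] Cor 5.3 (iii) p.144) [claim: Mochizuki2012, status: disputed] -/
theorem lift_comp_CdashBase :
    lift d hq β hβc σ hσ hσint hσq ⋙ d.CdashBase hq = d.CdashBase hq ⋙ CosetCat.pull (β : d.Gal →* d.Gal) hβc β.surjective :=
  (dataHomOver d hq β hβc σ hσ hσint hσq).functor_comp_baseFunctor

variable (hβc' : Continuous β.symm) (σ' : d.Ωˣ →* d.Ωˣ) (hσ' : ∀ (γ : d.Gal) (x : d.Ωˣ), σ' (γ • x) = β γ • σ' x)
  (hσ'int : ∀ x : d.Ωˣ, ValuativeRel.valuation d.Ω (x : d.Ω) ≤ 1 → ValuativeRel.valuation d.Ω (σ' x : d.Ω) ≤ 1)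
  (hσ'q : ∀ x : d.Ωˣ, (x : d.Ω) = algebraMap d.k d.Ω (q : d.k) →
    ValuativeRel.valuation d.Ω (σ' x : d.Ω) = ValuativeRel.valuation d.Ω (algebraMap d.k d.Ω (q : d.k)))
  (hinv : ∀ x, σ' (σ x) = x) (hinv' : ∀ x, σ (σ' x) = x)

/-- `β ∘ β⁻¹ = id` as monoid homomorphisms. [folklore] -/
private theorem comp_symm_eq_id : (β : d.Gal →* d.Gal).comp (β.symm : d.Gal →* d.Gal) = MonoidHom.id _ :=
  MonoidHom.ext β.apply_symm_apply

/-- `β⁻¹ ∘ β = id` as monoid homomorphisms. [folklore] -/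
private theorem symm_comp_eq_id : (β.symm : d.Gal →* d.Gal).comp (β : d.Gal →* d.Gal) = MonoidHom.id _ :=
  MonoidHom.ext β.symm_apply_apply

include hβc' σ' hσ' hσ'int hσ'q hinv hinv' in
/-- **`Ψ⊢_{β,σ}` is an EQUIVALENCE** when `σ` has an integral `β`-equivariant inverse `σ'` of the same valuation at `q̲` ([FrdI] Cor 5.4:
abc-iut-w5-d137 `functor_isEquivalence` over the equivalence `pull β`; `η`-components bijective for free, `β`-components by the brick's
`monoMulTransportβ_bijective`). [cite: MochizukiFrdI2008, Cor. 5.4 p.104] -/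
theorem lift_isEquivalence : (lift d hq β hβc σ hσ hσint hσq).IsEquivalence := by
  haveI : (CosetCat.pull (β : d.Gal →* d.Gal) hβc β.surjective).IsEquivalence :=
    (PiTransport.pullSelfEquiv (β : d.Gal →* d.Gal) (β.symm : d.Gal →* d.Gal) hβc hβc' (comp_symm_eq_id d β)
      (symm_comp_eq_id d β)).isEquivalence_functor
  refine (dataHomOver d hq β hβc σ hσ hσint hσq).functor_isEquivalence (fun X => ?_) (fun X => ?_)
  · exact PadicFrd.monoMulTransportη_bijective (DashSigmaLift.baseFunctor₁ d) (DashSigmaLift.baseFunctor₂ d β hβc)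
      (d.relEmb.img q) ((relEmbPull d β hβc).img q) (d.relEmb.isConstantSection hq) ((relEmbPull d β hβc).isConstantSection hq)
      d.fieldFunctor_isPadicLocal
      (GoodLocalFrobenioid.hlocOver (CosetCat.pull (β : d.Gal →* d.Gal) hβc β.surjective) d.fieldFunctor d.fieldFunctor_isPadicLocal)
      CosetCat.isConnected CosetCat.isTotallyEpimorphic (DashSigmaLift.tau d β hβc σ hσ) (DashSigmaLift.tau_integral d β hβc σ hσ hσint)
      (fun f u => DashSigmaLift.tau_natural d β hβc σ hσ f u) (tau_img d β hβc σ hσ hσq) (op X)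
  · exact PadicFrd.monoMulTransportβ_bijective (DashSigmaLift.baseFunctor₁ d) (DashSigmaLift.baseFunctor₂ d β hβc)
      (d.relEmb.img q) ((relEmbPull d β hβc).img q) (d.relEmb.isConstantSection hq) ((relEmbPull d β hβc).isConstantSection hq)
      d.fieldFunctor_isPadicLocal
      (GoodLocalFrobenioid.hlocOver (CosetCat.pull (β : d.Gal →* d.Gal) hβc β.surjective) d.fieldFunctor d.fieldFunctor_isPadicLocal)
      (DashSigmaLift.tau d β hβc σ hσ) (DashSigmaLift.tau_integral d β hβc σ hσ hσint) (tau_img d β hβc σ hσ hσq)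
      (DashSigmaLift.tau' d β hβc σ' hσ') (DashSigmaLift.tau'_integral d β hβc σ' hσ' hσ'int) (tau'_img d β hβc σ' hσ' hσ'q)
      (DashSigmaLift.tau'_tau d β hβc σ hσ σ' hσ' hinv) (DashSigmaLift.tau_tau' d β hβc σ hσ σ' hσ' hinv') (op X)

include hβc' σ' hσ' hσ'int hσ'q hinv hinv' in
/-- **THE MONO-ANALYTIC LIFT AT THE GENUINE BAD `𝒞⊢_v̲`**: for every `β ∈ Aut(G_v̲)` (continuous with continuous inverse) and every
`β⁻¹`-equivariant integral multiplicative `σ : K̄_v̲ˣ ⥲ K̄_v̲ˣ` preserving the valuation of `q̲_v̲` (integral inverse `σ'`), there is a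
self-equivalence of `𝒞⊢_v̲ = d.Cdash hq` (functor THE lift) LYING UNDER the transport `pullSelfEquiv β β⁻¹` of `𝒟⊢_v̲ = ℬ(G_v̲)⁰` through
`d.CdashBase hq` — print's route to Cor 5.3 (iii) through [AbsTopIII] Prop 5.8 (ii), as a THEOREM about the genuine construction once `σ` is
given (the LiftsAll⊢ content of the bad `⊢`-slot). ([IUTchI] Cor 5.3 (iii) p.144) [claim: Mochizuki2012, status: disputed] -/
theorem exists_selfEquivalence_liesUnder_pullSelfEquiv :
    ∃ Ψ : d.Cdash hq ≌ d.Cdash hq, Ψ.functor = lift d hq β hβc σ hσ hσint hσq ∧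
      Nonempty (CatIsomorphism.LiesUnder (d.CdashBase hq) (d.CdashBase hq) Ψ
        (PiTransport.pullSelfEquiv (β : d.Gal →* d.Gal) (β.symm : d.Gal →* d.Gal) hβc hβc' (comp_symm_eq_id d β) (symm_comp_eq_id d β))) := by
  haveI := lift_isEquivalence d hq β hβc σ hσ hσint hσq hβc' σ' hσ' hσ'int hσ'q hinv hinv'
  refine ⟨(lift d hq β hβc σ hσ hσint hσq).asEquivalence, rfl, ⟨?_⟩⟩
  change lift d hq β hβc σ hσ hσint hσq ⋙ d.CdashBase hq ≅ d.CdashBase hq ⋙ CosetCat.pull (β : d.Gal →* d.Gal) hβc _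
  exact eqToIso (lift_comp_CdashBase d hq β hβc σ hσ hσint hσq)

/-! ### §D. The lift carries `τ(q̲_v̲)` to `τ(q̲_v̲)` -/

/-- **Transport of a `c`-splitting reduces to transport of the rational function `c^m`** — the `c`-twin of abc-iut-L5-t16 gen 7's
`PadicFrd.Datum.map_pSplittingSubmonoid_eq_of_units` (same proof; generic in a `p`-adic Frobenioid datum `d'` and a family `c`; belongs
with `PadicFrobenioidSplittingTransport`). [cite: MochizukiFrdII2008, Rmk 1.2.2 p.10] -/
theorem map_cSplittingSubmonoid_eq_of_units {D : Type u} [Category.{u} D] (d' : PadicFrd.Datum D p)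
    (Ψ : d'.frobenioid ≌ d'.frobenioid) (ΨBase : D ⥤ D) [ΨBase.Faithful]
    (η : Ψ.functor ⋙ (ModelFrobenioid.data d'.Φ d'.B d'.divB).base ≅ (ModelFrobenioid.data d'.Φ d'.B d'.divB).base ⋙ ΨBase)
    (hdeg : ∀ ⦃X Y : d'.frobenioid⦄ (φ : X ⟶ Y), ModelFrobenioid.degFr (Ψ.functor.map φ) = ModelFrobenioid.degFr φ)
    (c : ∀ A : D, (d'.fld A)ˣ)
    (H : ∀ (X : d'.frobenioid) (w : X ⟶ X), w ∈ PreFrobenioid.endSubmonoid d'.structureFunctor X → ∀ m : ℕ,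
      d'.resK X.base (ModelFrobenioid.unit w) = c X.base ^ m ↔
        d'.resK (Ψ.functor.obj X).base (ModelFrobenioid.unit (Ψ.functor.map w)) = c (Ψ.functor.obj X).base ^ m)
    (X : d'.frobenioid) :
    (d'.cSplittingSubmonoid c X).map (Ψ.functor.mapEnd X) = d'.cSplittingSubmonoid c (Ψ.functor.obj X) := by
  ext w'
  constructor
  · rintro ⟨w, ⟨hw, m, hm⟩, rfl⟩
    exact ⟨(PadicFrd.Datum.map_mem_endSubmonoid_iff d' Ψ ΨBase η hdeg w).mpr hw, m, (H X w hw m).mp hm⟩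
  · rintro ⟨hw', m, hm'⟩
    have hpre : Ψ.functor.map (Ψ.functor.preimage (End.asHom w')) = End.asHom w' := Ψ.functor.map_preimage _
    have hw : Ψ.functor.preimage (End.asHom w') ∈ PreFrobenioid.endSubmonoid d'.structureFunctor X :=
      (PadicFrd.Datum.map_mem_endSubmonoid_iff d' Ψ ΨBase η hdeg _).mp (by rw [hpre]; exact hw')
    refine ⟨Ψ.functor.preimage (End.asHom w'), ⟨hw, m, (H X _ hw m).mpr ?_⟩, hpre⟩
    rw [hpre]
    exact hm'

/-- `u ↦ u|_{K^×}` on the powers of the distinguished element `q̲̂ = (q̲, log q̲)` of `B(A)` (abc-iut-L1 `Monogenic.liftGen`): `q̲̂^m ↦ q̲^m`.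
[cite: MochizukiFrdII2008, Thm 1.2 (v) p.10] -/
theorem resK_liftGen_pow (A : CosetCat d.Gal) (m : ℕ) :
    (d.dashDatum hq).resK A (Monogenic.liftGen d.fieldFunctor (d.relEmb.isConstantSection hq) (op A) ^ m) =
      PadicFrd.intNonzeroToUnits (d.fieldFunctor.obj A).K (d.relEmb.img q A) ^ m :=
  (map_pow ((d.dashDatum hq).resK A) (Monogenic.liftGen d.fieldFunctor (d.relEmb.isConstantSection hq) (op A)) m).trans rfl

/-- `u_{Ψ⊢ w} = β_A(u_w)` for the lift (abc-iut-L1 `DataHomOver.unit_functor_map`, spelled at the brick's `β`-component).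
[cite: MochizukiFrdI2008, Thm. 6.2 (i) p.110] -/
private theorem unit_lift_map {X Y : d.Cdash hq} (w : X ⟶ Y) :
    ModelFrobenioid.unit ((lift d hq β hβc σ hσ hσint hσq).map w) =
      PadicFrd.monoMulTransportβ (DashSigmaLift.baseFunctor₁ d) (DashSigmaLift.baseFunctor₂ d β hβc) (d.relEmb.img q)
        ((relEmbPull d β hβc).img q) (d.relEmb.isConstantSection hq) ((relEmbPull d β hβc).isConstantSection hq) d.fieldFunctor_isPadicLocal
        (GoodLocalFrobenioid.hlocOver (CosetCat.pull (β : d.Gal →* d.Gal) hβc β.surjective) d.fieldFunctor d.fieldFunctor_isPadicLocal)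
        (DashSigmaLift.tau d β hβc σ hσ) (DashSigmaLift.tau_integral d β hβc σ hσ hσint) (tau_img d β hβc σ hσ hσq) (op X.base)
        (ModelFrobenioid.unit w) :=
  (dataHomOver d hq β hβc σ hσ hσint hσq).unit_functor_map w

/-- **`H`, forward**: if a base-identity linear endomorphism `w` of `A` has rational function `q̲^m`, so does `Ψ⊢ w` — `u_w = q̲̂^m`
(`resK_injective`), `u_{Ψ⊢ w} = β_A(u_w) = β_A(q̲̂)^m = q̲̂^m` (the brick's `monoMulTransportβ_liftGen`). [cite: MochizukiFrdII2008, Thm 1.2 (v) p.10] -/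
theorem resK_unit_lift_map_eq {X : d.Cdash hq} (w : X ⟶ X) (m : ℕ)
    (hw : (d.dashDatum hq).resK X.base (ModelFrobenioid.unit w) = PadicFrd.intNonzeroToUnits (d.fieldFunctor.obj X.base).K (d.relEmb.img q X.base) ^ m) :
    (d.dashDatum hq).resK ((CosetCat.pull (β : d.Gal →* d.Gal) hβc β.surjective).obj X.base)
        (ModelFrobenioid.unit ((lift d hq β hβc σ hσ hσint hσq).map w)) =
      PadicFrd.intNonzeroToUnits (d.fieldFunctor.obj ((CosetCat.pull (β : d.Gal →* d.Gal) hβc β.surjective).obj X.base)).K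
          (d.relEmb.img q ((CosetCat.pull (β : d.Gal →* d.Gal) hβc β.surjective).obj X.base)) ^ m := by
  have hu : (ModelFrobenioid.unit w : ↥(Monogenic.BSub (DashSigmaLift.baseFunctor₁ d) (d.relEmb.isConstantSection hq) (op X.base))) =
      Monogenic.liftGen (DashSigmaLift.baseFunctor₁ d) (d.relEmb.isConstantSection hq) (op X.base) ^ m :=
    (d.dashDatum hq).resK_injective X.base (hw.trans (resK_liftGen_pow d hq X.base m).symm)
  rw [unit_lift_map, hu, map_pow, PadicFrd.monoMulTransportβ_liftGen]
  exact resK_liftGen_pow d hq ((CosetCat.pull (β : d.Gal →* d.Gal) hβc β.surjective).obj X.base) m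

include σ' hσ' hσ'int hσ'q hinv in
/-- **`H`, backward**: if `Ψ⊢ w` has rational function `q̲^m`, so does `w` — apply the inverse component `β'_A` (from `σ'`), which also fixes
`q̲̂` (`monoMulTransportβ_leftInverse`). [cite: MochizukiFrdII2008, Thm 1.2 (v) p.10] -/
theorem resK_unit_eq_of_lift_map {X : d.Cdash hq} (w : X ⟶ X) (m : ℕ)
    (hw' : (d.dashDatum hq).resK ((CosetCat.pull (β : d.Gal →* d.Gal) hβc β.surjective).obj X.base)
        (ModelFrobenioid.unit ((lift d hq β hβc σ hσ hσint hσq).map w)) =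
      PadicFrd.intNonzeroToUnits (d.fieldFunctor.obj ((CosetCat.pull (β : d.Gal →* d.Gal) hβc β.surjective).obj X.base)).K
          (d.relEmb.img q ((CosetCat.pull (β : d.Gal →* d.Gal) hβc β.surjective).obj X.base)) ^ m) :
    (d.dashDatum hq).resK X.base (ModelFrobenioid.unit w) =
      PadicFrd.intNonzeroToUnits (d.fieldFunctor.obj X.base).K (d.relEmb.img q X.base) ^ m := by
  -- `β_A(u_w) = q̲̂^m` by injectivity of `u ↦ u|_{K^×}` at the object `β⁻¹A`
  have e1 : PadicFrd.monoMulTransportβ (DashSigmaLift.baseFunctor₁ d) (DashSigmaLift.baseFunctor₂ d β hβc) (d.relEmb.img q)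
        ((relEmbPull d β hβc).img q) (d.relEmb.isConstantSection hq) ((relEmbPull d β hβc).isConstantSection hq) d.fieldFunctor_isPadicLocal
        (GoodLocalFrobenioid.hlocOver (CosetCat.pull (β : d.Gal →* d.Gal) hβc β.surjective) d.fieldFunctor d.fieldFunctor_isPadicLocal)
        (DashSigmaLift.tau d β hβc σ hσ) (DashSigmaLift.tau_integral d β hβc σ hσ hσint) (tau_img d β hβc σ hσ hσq) (op X.base)
          (ModelFrobenioid.unit w) =
      Monogenic.liftGen (DashSigmaLift.baseFunctor₂ d β hβc) ((relEmbPull d β hβc).isConstantSection hq) (op X.base) ^ m := by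
    refine (d.dashDatum hq).resK_injective ((CosetCat.pull (β : d.Gal →* d.Gal) hβc β.surjective).obj X.base) ?_
    rw [← unit_lift_map]
    exact hw'.trans (resK_liftGen_pow d hq ((CosetCat.pull (β : d.Gal →* d.Gal) hβc β.surjective).obj X.base) m).symm
  -- apply the inverse component `β'_A`
  have e2 : (ModelFrobenioid.unit w : ↥(Monogenic.BSub (DashSigmaLift.baseFunctor₁ d) (d.relEmb.isConstantSection hq) (op X.base))) =
      Monogenic.liftGen (DashSigmaLift.baseFunctor₁ d) (d.relEmb.isConstantSection hq) (op X.base) ^ m := by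
    rw [← PadicFrd.monoMulTransportβ_leftInverse (DashSigmaLift.baseFunctor₁ d) (DashSigmaLift.baseFunctor₂ d β hβc) (d.relEmb.img q)
      ((relEmbPull d β hβc).img q) (d.relEmb.isConstantSection hq) ((relEmbPull d β hβc).isConstantSection hq) d.fieldFunctor_isPadicLocal
      (GoodLocalFrobenioid.hlocOver (CosetCat.pull (β : d.Gal →* d.Gal) hβc β.surjective) d.fieldFunctor d.fieldFunctor_isPadicLocal)
      (DashSigmaLift.tau d β hβc σ hσ) (DashSigmaLift.tau_integral d β hβc σ hσ hσint) (tau_img d β hβc σ hσ hσq)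
      (DashSigmaLift.tau' d β hβc σ' hσ') (DashSigmaLift.tau'_integral d β hβc σ' hσ' hσ'int) (tau'_img d β hβc σ' hσ' hσ'q)
      (DashSigmaLift.tau'_tau d β hβc σ hσ σ' hσ' hinv) (op X.base) (ModelFrobenioid.unit w),
      e1, map_pow, PadicFrd.monoMulTransportβ_liftGen]
  rw [e2]
  exact resK_liftGen_pow d hq X.base m

include hβc' hσ' hσ'int hσ'q hinv hinv' in
/-- **THE LIFT CARRIES `τ(q̲_v̲)` TO `τ(q̲_v̲)`** (c-splitting form): for every object `A` of `𝒞⊢_v̲`, `Ψ⊢_{β,σ}` maps the `c`-splitting of the family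
`X ↦ q̲̂_X` (abc-iut-L1 `Datum.cSplittingSubmonoid`; = `BadLocalKit.tauDash`, = abc-iut-L5-t2's `GaloisValDatum.tauDashOf hq q̲`) at `A` ONTO that at
`Ψ⊢ A` — `map_cSplittingSubmonoid_eq_of_units` with base data `(pull β, lift_comp_CdashBase)` and `H` = the two lemmas above.
([IUTchI] Cor 5.3 (iii) p.144) [claim: Mochizuki2012, status: disputed] -/
theorem map_cSplittingSubmonoid_img_lift (X : d.Cdash hq) :
    ((d.dashDatum hq).cSplittingSubmonoid (fun A => PadicFrd.intNonzeroToUnits (d.fieldFunctor.obj A).K (d.relEmb.img q A)) X).map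
        ((lift d hq β hβc σ hσ hσint hσq).mapEnd X) =
      (d.dashDatum hq).cSplittingSubmonoid (fun A => PadicFrd.intNonzeroToUnits (d.fieldFunctor.obj A).K (d.relEmb.img q A))
        ((lift d hq β hβc σ hσ hσint hσq).obj X) := by
  haveI := lift_isEquivalence d hq β hβc σ hσ hσint hσq hβc' σ' hσ' hσ'int hσ'q hinv hinv'
  haveI : (CosetCat.pull (β : d.Gal →* d.Gal) hβc β.surjective).Faithful := CosetCat.pull_faithful _ _ _
  exact map_cSplittingSubmonoid_eq_of_units (d.dashDatum hq) (lift d hq β hβc σ hσ hσint hσq).asEquivalence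
    (CosetCat.pull (β : d.Gal →* d.Gal) hβc β.surjective) (eqToIso (lift_comp_CdashBase d hq β hβc σ hσ hσint hσq)) (fun _ _ _ => rfl)
    (fun A => PadicFrd.intNonzeroToUnits (d.fieldFunctor.obj A).K (d.relEmb.img q A))
    (fun Y w _ m => ⟨resK_unit_lift_map_eq d hq β hβc σ hσ hσint hσq w m,
      resK_unit_eq_of_lift_map d hq β hβc σ hσ hσint hσq σ' hσ' hσ'int hσ'q hinv w m⟩) X

include hβc' hσ' hσ'int hσ'q hinv hinv' in
/-- **The same for abc-iut-L1-t4's `BadLocalKit.tauDash`** (`τ_v⊢ := τ(q̲)`): the lift maps `τ(q̲_v̲)(A)` onto `τ(q̲_v̲)(Ψ⊢ A)`.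
([IUTchI] Cor 5.3 (iii) p.144) [claim: Mochizuki2012, status: disputed] -/
theorem map_tauDash_lift (X : d.Cdash hq) :
    ((PadicFrd.BadLocalKit.tauDash d.relEmb d.fieldFunctor_isPadicLocal CosetCat.isConnected CosetCat.isTotallyEpimorphic hq).τ X).map
        ((lift d hq β hβc σ hσ hσint hσq).mapEnd X) =
      (PadicFrd.BadLocalKit.tauDash d.relEmb d.fieldFunctor_isPadicLocal CosetCat.isConnected CosetCat.isTotallyEpimorphic hq).τ
        ((lift d hq β hβc σ hσ hσint hσq).obj X) := by
  rw [PadicFrd.BadLocalKit.tauDash, PadicFrd.BadLocalKit.tauDashOf_τ]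
  exact map_cSplittingSubmonoid_img_lift d hq β hβc σ hσ hσint hσq hβc' σ' hσ' hσ'int hσ'q hinv hinv' X

include hβc' hσ' hσ'int hσ'q hinv hinv' in
/-- **The same in abc-iut-L5-t2's vocabulary** (`S3Local.CharSplitting.IsPreservedBy`): the member `d.tauDashOf hq q̲_v̲` of `τ⊢_v̲` determined by the
datum's OWN root `q̲_v̲` (= racer C's `(frobeniusBadAt …).tauDash`, rfl) is PRESERVED by the lift. ([IUTchI] Cor 5.3 (iii) p.144) [claim: Mochizuki2012, status: disputed] -/
theorem isPreservedBy_tauDashOf_self_lift :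
    (d.tauDashOf hq q).IsPreservedBy (d.tauDashOf hq q) (lift d hq β hβc σ hσ hσint hσq) := by
  intro X
  rw [d.tauDashOf_sect hq q (Associated.refl q) X, d.tauDashOf_sect hq q (Associated.refl q)]
  exact map_cSplittingSubmonoid_img_lift d hq β hβc σ hσ hσint hσq hβc' σ' hσ' hσ'int hσ'q hinv hinv' X

end Lift

end BadDashSigmaLift

end Literature.IUT.HodgeTheaters

end
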